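import Mathlib
import Summits.ValiantsHypothesis.ValiantsHypothesis.Theorems.ProofCarryingSymmetryRestorationQPESatCR
import Summits.ValiantsHypothesis.ValiantsHypothesis.Theorems.ProofCarryingSymmetryRestorationQPDistStability

/-!
# Route ProofCarryingSymmetry — crux `RestorationQP`, line `registered`: the leaf-count rigidity at
distributivity budget one — an INERT instance buys nothing

Support file for the crux item `stmt-ValiantsHypothesis-10343` (lead c5, cycle 5), complementing the
rung S3^(1)-inv (`…ESatStability`).  The "μ-lemma" of CYCLE5-REPORT §CORE(1).1, formally:

* `esat_rigid` — on a NORMAL FORM the e-saturation of a generic instance either changes nothing or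
  STRICTLY INCREASES the number of variable leaves (every peel trades the pattern, of leaf weight
  `nvars p + nvars s`, for the expansion, of leaf weight `2·nvars p + nvars s` — `nvars_epeel` — and
  normal forms have no dead subterms, so no peel is ever discarded);
* `acEq_cnorm_of_ucEqWith_of_inert` — hence if the instance is INERT for `C` (saturation does not
  touch `cnorm C•`) then congruence of `(C∘σ)•` and `C•` modulo the fragment AND the instance already
  forces AC-equivalence of the constant-normal forms: the instance was never usable, because `(C∘σ)•`
  has as many leaves as `C•`;
* `stabilityAtDistOne_of_inert` — so, WITHOUT any invariance hypothesis on the instance, an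
  `S_n`-symmetric circuit of size `≤ (|C|+n+2)^6` computes `Ĉ` (lead c2's engine on `cnormClass C`).

With the rung: for ONE generic instance serving all `σ`, either it is inert (this file), or it fires
and then its invariance gives restoration (`stabilityAtDistOne_invariantGeneric`).  Everything proved.
-/

-- single-problem summit: `Summit.ValiantsHypothesis.ValiantsHypothesis.…` is the namespace by design (D-0017)
set_option linter.dupNamespace false

noncomputable section

open scoped Classical

namespace Summit.ValiantsHypothesis.ValiantsHypothesis.Theorems

namespace ACStability

open Literature.Computability.AlgebraicComplexity ACClass

universe u v

variable {𝔽 : Type u} [Field 𝔽] {X : Type v} {d : DistData 𝔽 X}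

/-! ### Leaf counts under peeling -/

omit [Field 𝔽] in
/-- The leaf weight of `k` copies of a multiset of classes. [folklore] -/
theorem nvars_sum_nsmul (k : ℕ) (K : Multiset (ACClass 𝔽 X)) :
    ((k • K).map ACClass.nvars).sum = k * (K.map ACClass.nvars).sum := by
  rw [Multiset.map_nsmul, Multiset.sum_nsmul, smul_eq_mul]

/-- **Peeling `k` copies raises the leaf count by exactly `k · nvars p`.** [folklore] -/
theorem nvars_epeel (hg : d.Generic) {x : PIFormula 𝔽 X} (hx : NF x) :
    nvars (epeel d x) = nvars x + kmax (mset x) d.pat * nvars d.p := by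
  set k := kmax (mset x) d.pat with hk
  have hle : k • d.pat ≤ mset x := nsmul_kmax_le _ _
  have h := mset_nvars_sum (epeel d x)
  rw [mset_epeel hg hx, ← hk, Multiset.map_add, Multiset.sum_add, Multiset.map_replicate,
    Multiset.sum_replicate, nvars_mk, smul_eq_mul, hg.nvars_sig] at h
  have hsub : ((mset x - k • d.pat).map ACClass.nvars).sum + k * (nvars d.p + (nvars d.q + nvars d.r)) =
      nvars x := by
    rw [← d.nvars_s, ← DistData.patVars, ← DistData.pat_nvars_sum, ← nvars_sum_nsmul, ← Multiset.sum_add,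
      ← Multiset.map_add, tsub_add_cancel_of_le hle, mset_nvars_sum]
  have e : nvars (epeel d x) + k * (nvars d.p + (nvars d.q + nvars d.r)) =
      nvars x + k * (2 * nvars d.p + nvars d.q + nvars d.r) := by
    rw [← h, ← hsub]; ring
  have e' : k * (2 * nvars d.p + nvars d.q + nvars d.r) =
      k * nvars d.p + k * (nvars d.p + (nvars d.q + nvars d.r)) := by ring
  omega

/-- A normal form without variable leaves is a bare constant. [folklore] -/
theorem NF.eq_const_of_nvars {x : PIFormula 𝔽 X} (hx : NF x) (h : nvars x = 0) : ∃ c, x = .const c := by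
  induction x with
  | var y => simp at h
  | const c => exact ⟨c, rfl⟩
  | add a b iha _ =>
    obtain ⟨hl, ha, -⟩ := nf_add_iff.1 hx
    obtain ⟨c, rfl⟩ := iha ha (by simp at h; omega)
    exact absurd hl.1 (not_apure_const c)
  | mul a b iha _ =>
    obtain ⟨hl, ha, -⟩ := nf_mul_iff.1 hx
    obtain ⟨c, rfl⟩ := iha ha (by simp at h; omega)
    exact absurd hl.1 (not_mpure_const c)

/-- A normal form with a nonzero leaf count has a nonzero root constant. [folklore] -/
theorem NF.mcst_ne_zero_of_nvars {x : PIFormula 𝔽 X} (hx : NF x) (h : nvars x ≠ 0) : mcst x ≠ 0 := fun h0 =>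
  h (by rw [hx.eq_const_zero_of_msplit h0]; rfl)

/-- **Rigidity of the e-saturation on normal forms.**  For a generic instance and a normal form `x`:
the leaf count never drops, a nonzero root constant stays nonzero, and EITHER `esat d x = x` OR the
leaf count grows by at least `nvars p`. [folklore] -/
theorem esat_rigid (hg : d.Generic) {x : PIFormula 𝔽 X} (hx : NF x) :
    nvars x ≤ nvars (esat d x) ∧ (mcst x ≠ 0 → mcst (esat d x) ≠ 0) ∧
      (esat d x = x ∨ nvars x + nvars d.p ≤ nvars (esat d x)) := by
  induction x with
  | var y => exact ⟨le_rfl, id, Or.inl rfl⟩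
  | const c => exact ⟨le_rfl, id, Or.inl rfl⟩
  | add a b iha ihb =>
    obtain ⟨hl, ha, hb⟩ := nf_add_iff.1 hx
    obtain ⟨ha1, -, ha3⟩ := iha ha
    obtain ⟨hb1, -, hb3⟩ := ihb hb
    have hsum : nvars (esat d (.add a b)) = nvars (esat d a) + nvars (esat d b) := by
      rw [esat_add, nvars_sadd]
    have h1 : nvars (.add a b) ≤ nvars (esat d (.add a b)) := by
      rw [hsum, nvars_add]; exact Nat.add_le_add ha1 hb1
    refine ⟨h1, fun _ => ?_, ?_⟩
    · -- the value is a normal form with a variable leaf, hence not the constant `0`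
      refine (nf_esat hg _).mcst_ne_zero_of_nvars fun h0 => ?_
      have hpos : nvars (.add a b) ≠ 0 := fun h => by
        obtain ⟨c, hc⟩ := hx.eq_const_of_nvars h
        cases hc
      omega
    · rcases ha3 with ha3 | ha3
      · rcases hb3 with hb3 | hb3
        · left; rw [esat_add, ha3, hb3]; exact sadd_eq_of_localNF hl
        · right; rw [hsum, nvars_add]; omega
      · right; rw [hsum, nvars_add]; omega
  | mul a b iha ihb =>
    obtain ⟨hl, ha, hb⟩ := nf_mul_iff.1 hx
    obtain ⟨ha1, ha2, ha3⟩ := iha ha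
    obtain ⟨hb1, hb2, hb3⟩ := ihb hb
    -- the root constants of `a`, `b` are nonzero (local normal form), hence so are those of their
    -- e-saturations, and the smart product does not collapse
    have hma : mcst a ≠ 0 := by rw [mcst_def, hl.1.msplit_eq]; exact one_ne_zero
    have hmb : mcst b ≠ 0 := by
      rcases hl.2 with ⟨k, hk0, -, rfl⟩ | hP
      · exact hk0
      · rw [mcst_def, hP.msplit_eq]; exact one_ne_zero
    have h0 : mcst (esat d a) * mcst (esat d b) ≠ 0 := mul_ne_zero (ha2 hma) (hb2 hmb)
    have hnfa := nf_esat hg a; have hnfb := nf_esat hg b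
    have hx' : NF (smul (esat d a) (esat d b)) := nf_smul hnfa hnfb
    have hsm : nvars (smul (esat d a) (esat d b)) = nvars (esat d a) + nvars (esat d b) :=
      nvars_smul_of_ne _ _ (by rwa [mcst_def, mcst_def] at h0)
    have hpeel := nvars_epeel hg hx'
    have hval : nvars (esat d (.mul a b)) =
        nvars (esat d a) + nvars (esat d b) + kmax (mset (smul (esat d a) (esat d b))) d.pat * nvars d.p := by
      rw [esat_mul, emul, hpeel, hsm]
    refine ⟨?_, fun _ => ?_, ?_⟩
    · rw [hval, nvars_mul]; have := Nat.add_le_add ha1 hb1; omega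
    · rw [esat_mul, (mset_emul hg hnfa hnfb h0).2]
      exact mul_ne_zero h0 (pow_ne_zero _ (inv_ne_zero hg.cP_ne_zero))
    · rcases ha3 with ha3 | ha3
      · rcases hb3 with hb3 | hb3
        · -- both factors are fixed: the question is whether the product itself peels
          have hsmul : smul (esat d a) (esat d b) = .mul a b := by rw [ha3, hb3]; exact smul_eq_of_localNF hl
          by_cases hk : kmax (mset (PIFormula.mul a b)) d.pat = 0
          · left; rw [esat_mul, emul, hsmul, epeel_of_saturated hk]
          · right
            have hk1 : 1 ≤ kmax (mset (PIFormula.mul a b)) d.pat := Nat.one_le_iff_ne_zero.2 hk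
            rw [hval, ha3, hb3]
            rw [ha3, hb3] at hsmul
            rw [hsmul, nvars_mul]
            nlinarith
        · right; rw [hval, nvars_mul]; nlinarith
      · right; rw [hval, nvars_mul]; nlinarith

/-! ### An inert instance buys nothing -/

/-- **Budget-one congruence with an instance that is INERT for `C` forces AC-equivalence of the
constant-normal forms** — no invariance of the instance is assumed. [folklore] -/
theorem acEq_cnorm_of_ucEqWith_of_inert (hg : d.Generic) {C : PICircuit 𝔽 X}
    (hinert : esat d (cnorm C.unfold) = cnorm C.unfold) (f : X → X)
    (h : UCEqWith d.eqn (C.rename f).unfold C.unfold) :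
    ACEq (cnorm (C.rename f).unfold) (cnorm C.unfold) := by
  have e1 : ACEq (esat d (cnorm (C.rename f).unfold)) (cnorm C.unfold) := by
    rw [← hinert]
    exact ((acEq_esat_of_ucEq hg (ucEq_cnorm _)).symm.trans (acEq_esat_of_ucEqWith hg h)).trans
      (acEq_esat_of_ucEq hg (ucEq_cnorm _))
  have hn : nvars (esat d (cnorm (C.rename f).unfold)) = nvars (cnorm (C.rename f).unfold) := by
    rw [e1.nvars_eq, PICircuit.unfold_rename, cnorm_rename, nvars_rename]
  rcases (esat_rigid hg (nf_cnorm (C.rename f).unfold)).2.2 with hfix | hlt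
  · rw [hfix] at e1; exact e1
  · have := hg.1; omega

/-- **Stability at distributivity budget one with an INERT instance.**  If a generic instance does not
fire on `cnorm C•` and makes `(C∘σ)•`, `C•` congruent for every `σ`, then the AC-canonical circuit of
`cnormClass C` is `Γ`-symmetric, computes `Ĉ` and is small. [folklore] -/
theorem exists_isSymmetric_of_inert {Γ : Type*} [Group Γ] [MulAction Γ X] (hg : d.Generic)
    (C : PICircuit 𝔽 X) (hinert : esat d (cnorm C.unfold) = cnorm C.unfold)
    (h : ∀ γ : Γ, UCEqWith d.eqn (C.rename fun x => γ • x).unfold C.unfold) :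
    ∃ (G : Type (max u v)) (_ : Fintype G) (D : LabelledArithCircuit 𝔽 X Unit G),
      D.IsSymmetric Γ ∧ D.eval (D.output ()) = C.eval ∧
      Fintype.card G ≤ 2 * (3 * (C.size + 1)) + 2 * (C.size + 3) * (3 * (C.size + 1)) ^ 2 := by
  have hL : ∀ q ∈ reach (cnormClass C), Multiset.card q.kids < 2 ^ (C.size + 3) :=
    fun _ hq => card_kids_lt_of_mem_reach_cnormClass hq
  have ht : ∀ γ : Γ, γ • cnormClass C = cnormClass C := fun γ => by
    rw [smul_cnormClass]
    exact mk_eq_mk.2 (acEq_cnorm_of_ucEqWith_of_inert hg hinert _ (h γ))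
  exact ⟨ACGate (cnormClass C) (C.size + 3), inferInstance, acCircuit (cnormClass C) (C.size + 3) hL,
    isSymmetric_acCircuit hL ht, (eval_output_acCircuit hL).trans (eval_cnormClass C),
    card_acGate_le (3 * (C.size + 1)) (card_reach_cnormClass_le C)⟩

end ACStability

open Literature.Computability.AlgebraicComplexity

/-- **Stability at distributivity budget ONE with an INERT instance — the leaf-count rigidity** (line
`registered` of crux `RestorationQP`, item stmt-ValiantsHypothesis-10343; companion of the rung
`stabilityAtDistOne_invariantGeneric`).  If a GENERIC ground distributivity instance
`e : P·(Q+R) = P·Q + P·R` does not fire on the constant-normal form of `C•`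
(`esat d (cnorm C•) = cnorm C•`) and yet, for every `σ ∈ S_n`, the unfoldings `(C∘σ)•` and `C•` are
congruent modulo the distributivity-free fragment AND `e`, then an `S_n`-symmetric labelled circuit of
size `≤ (|C|+n+2)^6` computes `Ĉ`: the e-saturation of a normal form either fixes it or strictly
increases its number of variable leaves (`ACStability.esat_rigid`), and `(C∘σ)•` has as many leaves as
`C•`, so the instance was never usable and lead c2's rung S3⁗ applies.  No invariance of `e` is assumed.
[folklore] -/
theorem stabilityAtDistOne_of_inert : ∃ c : ℕ, ∀ (n : ℕ) (C : PICircuit ℂ (Fin n × Fin n)) (d : ACStability.DistData ℂ (Fin n × Fin n)), d.Generic → ACStability.esat d (ACStability.cnorm C.unfold) = ACStability.cnorm C.unfold → (∀ σ : Equiv.Perm (Fin n), ACStability.UCEqWith d.eqn (C.rename fun x : Fin n × Fin n => σ • x).unfold C.unfold) → ∃ (G : Type) (_ : Fintype G) (D : LabelledArithCircuit ℂ (Fin n × Fin n) Unit G), D.IsSymmetric (Equiv.Perm (Fin n)) ∧ D.eval (D.output ()) = C.eval ∧ Fintype.card G ≤ (C.size + n + 2) ^ c := by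
  refine ⟨6, fun n C d hg hinert h => ?_⟩
  obtain ⟨G, hG, D, hsym, hev, hcard⟩ :=
    ACStability.exists_isSymmetric_of_inert (Γ := Equiv.Perm (Fin n)) hg C hinert h
  exact ⟨G, hG, D, hsym, hev, hcard.trans (ACStability.dist_gate_bound C.size n)⟩

end Summit.ValiantsHypothesis.ValiantsHypothesis.Theorems

end
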